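import Summits.CriticalPhenomena.PercolationContinuityZ3.Theorems.Transplant.SkeletonSign1UnitRangeCert
import Summits.CriticalPhenomena.PercolationContinuityZ3.Theorems.Transplant.SkelSign1Holds
import HarnessLib

/-!
# The single-type D″ customers, UNCONDITIONAL: `θ(p_c) = 0` on `𝕋 × ℤ` (the lane's target `StackedTriangularOwnCriticalContinuity`), on
# `Cay(ℤ³; ±eᵢ, ±(e₀+e₂))` and `Cay(ℤ³; ±eᵢ, ±(e₀+e₁))`, on the x-decorated slab, on every `flipY`/`flipYZ`-invariant or flip-certified
# unit-range `Cay(ℤ³; S)` and on `Cay(H₃(ℤ); a, b, ac)` — the `…_of_signNode₁` corollaries (`SkeletonSign1Customers` p253416,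
# `SkeletonSign1UnitRangeCert` p254555) applied to the closure `samePDropOfSkeletonSign₁_holds` (`SkelSign1Holds`).  The side-on PRODUCT customers
# (`ℍ □ ℤ`, `N_{m,2} □ ℤ`, `Cay(H₃; S) □ ℤ`, `(X □ Y) □ ℤ`, `X □ ℤ`) are in the sibling file `SkeletonSign1ProductsHolds`

builds on p205010 (kernel theorem, internal audit signed; external expert review pending).
Lane `prim-bschramm`, seat `prim-bschramm-p1` (gen 10); helper file (`--supports stmt-CriticalPhenomena-4575`); PROOFS ONLY (one-liners).
NO HEADLINE FROM THIS SEAT (closing protocol: lead probe → p5 audit → p1 kit → lead's headlines, `𝕋 × ℤ` first).  The kagome customer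
`kagome □ ℤ` is NOT here: its skeleton has three base types (multi-type node `SamePDropOfSkeletonSign`, open).
[cite: BenjaminiSchramm1996, Conj. 4] [cite: GrimmettPercolation1999, §12.1 p. 349 (stacked planar lattices)]
-/

noncomputable section

namespace Summit.CriticalPhenomena.PercolationContinuityZ3.Theorems.Transplant

open MeasureTheory Literature.Probability.Percolation Literature.Probability.LatticeModels SimpleGraph

/-- **`θ_{𝕋×ℤ}(p_c) = 0`: the lane's target `StackedTriangularOwnCriticalContinuity` HOLDS.** [cite: BenjaminiSchramm1996, Conj. 4] -/
theorem stackedTriangularOwnCriticalContinuity_holds : StackedTriangularOwnCriticalContinuity :=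
  stackedTriangularOwnCriticalContinuity_of_signNode₁ samePDropOfSkeletonSign₁_holds

/-- `θ_{𝕋□ℤ}(x, p_c) = 0` at every vertex. [cite: BenjaminiSchramm1996, Conj. 4] -/
theorem stackedTriangular_criticalContinuity_holds (x : Site 2 × Site 1) :
    theta stackedTriangularGraph x (criticalProbIOf stackedTriangularGraph x) = 0 :=
  stackedTriangular_criticalContinuity_of_signNode₁ samePDropOfSkeletonSign₁_holds x

/-- `θ(v, p_c) = 0` at every vertex of `Cay(ℤ³; ±e₀, ±e₁, ±e₂, ±(e₀+e₂))`. [cite: BenjaminiSchramm1996, Conj. 4] -/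
theorem z3Diagonal_criticalContinuity_holds (v : Site 3) : theta Z3Diag.dgGraph v (criticalProbIOf Z3Diag.dgGraph v) = 0 :=
  Z3Diag.z3Diagonal_criticalContinuity_of_signNode₁' samePDropOfSkeletonSign₁_holds v

/-- `θ(v, p_c) = 0` at every vertex of the x-decorated slab. [cite: BenjaminiSchramm1996, Conj. 4] -/
theorem decoratedSlab_criticalContinuity_holds (v : DecoratedSlab.DS) :
    theta DecoratedSlab.dsGraph v (criticalProbIOf DecoratedSlab.dsGraph v) = 0 :=
  DecoratedSlab.decoratedSlab_criticalContinuity_of_signNode₁' samePDropOfSkeletonSign₁_holds v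

/-- `θ(v, p_c) = 0` on every `flipY`-invariant unit-range `Cay(ℤ³; S)`. [cite: BenjaminiSchramm1996, Conj. 4] -/
theorem unitGens_criticalContinuity_of_flipY_holds (U : UnitGens) (hS : ∀ s ∈ U.S, Z3Diag.flipY s ∈ U.S) (v : Site 3) :
    theta U.graph v (criticalProbIOf U.graph v) = 0 :=
  U.criticalContinuity_of_signNode₁_of_flipY samePDropOfSkeletonSign₁_holds hS v

/-- `θ(v, p_c) = 0` on every `flipYZ`-invariant unit-range `Cay(ℤ³; S)`. [cite: BenjaminiSchramm1996, Conj. 4] -/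
theorem unitGens_criticalContinuity_of_flipYZ_holds (U : UnitGens) (hS : ∀ s ∈ U.S, UnitGens.flipYZ s ∈ U.S) (v : Site 3) :
    theta U.graph v (criticalProbIOf U.graph v) = 0 :=
  U.criticalContinuity_of_signNode₁_of_flipYZ samePDropOfSkeletonSign₁_holds hS v

/-- `θ(x, p_c) = 0` at every vertex of `Cay(H₃(ℤ); a, b, ac)`. [cite: BenjaminiSchramm1996, Conj. 4] -/
theorem heisAC_criticalContinuity_holds (x : ℤ × ℤ × ℤ) : theta HeisAC.X₁ x (criticalProbIOf HeisAC.X₁ x) = 0 :=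
  HeisAC.criticalContinuity_of_signNode₁' samePDropOfSkeletonSign₁_holds x

/-- `θ(v, p_c) = 0` at every vertex of `Cay(ℤ³; ±e₀, ±e₁, ±e₂, ±(e₀+e₁))` (p2-g7's carrier `TriZ.U` of `𝕋 × ℤ`). [cite: BenjaminiSchramm1996, Conj. 4] -/
theorem triZ_criticalContinuity_holds (v : Site 3) : theta TriZ.U.graph v (criticalProbIOf TriZ.U.graph v) = 0 :=
  TriZ.triZ_criticalContinuity_of_signNode₁' samePDropOfSkeletonSign₁_holds v

/-- **`θ(v, p_c) = 0` on every unit-range `Cay(ℤ³; S)` whose flip search `HasFlipCert` succeeds** (`decide` per member; `SkeletonSign1UnitRangeCert`).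
[cite: BenjaminiSchramm1996, Conj. 4] -/
theorem unitGens_criticalContinuity_of_hasFlipCert_holds (U : UnitGens) (h : U.HasFlipCert) (v : Site 3) :
    theta U.graph v (criticalProbIOf U.graph v) = 0 :=
  UnitGens.criticalContinuity_of_signNode₁_of_hasFlipCert h samePDropOfSkeletonSign₁_holds v

/-- **The single-type customer list HOLDS, in one conjunction** (`sign₁Customers_of_signNode₁` applied to the closure): the lane's target for
`𝕋 × ℤ`; `θ(p_c) = 0` at every vertex of `𝕋 × ℤ`, of `Cay(ℤ³; ±eᵢ, ±(e₀+e₂))`, of the x-decorated slab, of every `flipY`- or `flipYZ`-invariant or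
`flipY`-relabelled unit-range `Cay(ℤ³; S)`, and of `Cay(H₃(ℤ); a, b, ac)`. [cite: BenjaminiSchramm1996, Conj. 4] -/
theorem sign₁Customers_holds :
    StackedTriangularOwnCriticalContinuity ∧
      (∀ x : Site 2 × Site 1, theta stackedTriangularGraph x (criticalProbIOf stackedTriangularGraph x) = 0) ∧
      (∀ v : Site 3, theta Z3Diag.dgGraph v (criticalProbIOf Z3Diag.dgGraph v) = 0) ∧
      (∀ v : DecoratedSlab.DS, theta DecoratedSlab.dsGraph v (criticalProbIOf DecoratedSlab.dsGraph v) = 0) ∧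
      (∀ U : UnitGens, (∀ s ∈ U.S, Z3Diag.flipY s ∈ U.S) → ∀ v : Site 3, theta U.graph v (criticalProbIOf U.graph v) = 0) ∧
      (∀ U : UnitGens, (∀ s ∈ U.S, UnitGens.flipYZ s ∈ U.S) → ∀ v : Site 3, theta U.graph v (criticalProbIOf U.graph v) = 0) ∧
      (∀ (U : UnitGens) (π : Equiv.Perm (Fin 3)), (∀ s ∈ (U.relabel π).S, Z3Diag.flipY s ∈ (U.relabel π).S) →
        ∀ v : Site 3, theta U.graph v (criticalProbIOf U.graph v) = 0) ∧
      (∀ x : ℤ × ℤ × ℤ, theta HeisAC.X₁ x (criticalProbIOf HeisAC.X₁ x) = 0) :=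
  sign₁Customers_of_signNode₁ samePDropOfSkeletonSign₁_holds

end Summit.CriticalPhenomena.PercolationContinuityZ3.Theorems.Transplant

end
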